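import Summits.BirchSwinnertonDyer.BirchSwinnertonDyer.Theorems.PrintCFramOrbitImcLine
import Summits.BirchSwinnertonDyer.BirchSwinnertonDyer.Theses.PrintCFram
import HarnessLib

/-!
# Route-level companion of line «orbit-imc»: the ROUTE DECL r6 `Theses.PrintCFram.AnticyclotomicIndexLawThree`
# (item stmt-BirchSwinnertonDyer-23006) BY NAME from JLK's named fact ∧ (A𝒪)ᴳʳ-slice ∧ (B𝒪)♮-slice ∧
# (PR|IMC)₃♮-slice (cell `bsd-print-cfram`, D-0131 (2) PRINT tier, prover seat p2 gen 3;
# `--supports stmt-BirchSwinnertonDyer-23006`)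

One theorem AGAINST THE ROUTE DECL (this file imports the Theses cone; the line file
`PrintCFramOrbitImcLine.lean` is route-independent): `anticyclotomicIndexLawThree_of_orbitImc` =
`OrbitImc.forall_indexAtThreeT_of_orbitImc` re-typed with conclusion `Theses.PrintCFram.AnticyclotomicIndexLawThree`
(the item body is that conclusion verbatim, so the proof is the line consumer itself). This is the
composition the skeleton «orbit-imc» registers on r6: stubs `stub_sec54` (JLK §5.4 named fact),
`stub_orbitGr : AcDescentThreeOrbit.AcMainConjectureOrbitGrThree`, `stub_readingGr :
OrbitImc.AcBottomReadingGrThree`, `stub_lawGr : ∀ W …, HasCM → CMRamified W 3 → analyticRank = 1 →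
X12.O11.RamifiedCMBottomClassIndexLawAtZpThreeGr W`. CONDITIONAL (hypotheses displayed); nothing asserted;
r6, C1 and the leaf stay OPEN. «beyond-print theorem»: NO.

References: [JohnsonLeungKings2011] §5.4; [BurungaleKobayashiNakamuraOta2026] arXiv:2608.06879v1
§3.2.2, Thm. 3.14, §1.4 (claim; preprint); [PollackWeston2011] §3 Prop. 3.7; [GreenbergLNM1716] §4
Prop. 4.13; cell STATUS planner 21:44:17Z / 21:56:48Z (r6 filed), ty2 21:59:12Z.
-/

-- the summit namespace `Summit.BirchSwinnertonDyer.BirchSwinnertonDyer` repeats the problem name by design (D-0017)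
set_option linter.dupNamespace false

noncomputable section

open WeierstrassCurve Literature.NumberTheory.EllipticCurves Literature.NumberTheory.EllipticCurves.Rank1Residual
  Literature.NumberTheory.ComplexMultiplication.EllipticUnits.JohnsonLeungKings2011
  Summit.BirchSwinnertonDyer.Rank1Residual.X12.O11
  Summit.BirchSwinnertonDyer.BirchSwinnertonDyer.Theses.PrintCFram
  Summit.BirchSwinnertonDyer.BirchSwinnertonDyer.Theorems.PrintCFram.AcDescentThreeOrbit

namespace Summit.BirchSwinnertonDyer.BirchSwinnertonDyer.Theorems.PrintCFram.OrbitImc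

/-- **r6 `Theses.PrintCFram.AnticyclotomicIndexLawThree` BY NAME from JLK's named fact ∧ (A𝒪)ᴳʳ-slice
∧ (B𝒪)♮-slice ∧ (PR|IMC)₃♮-slice** (PROVED: the line consumer `forall_indexAtThreeT_of_orbitImc`; the
item body is its conclusion verbatim). CONDITIONAL on the four displayed hypotheses.
[cite: JohnsonLeungKings2011, §5.4 (arXiv:0804.2828 p0016:L19–26)]
[cite: GreenbergLNM1716, §4 Prop. 4.13 (the defect terms)] -/
theorem anticyclotomicIndexLawThree_of_orbitImc (h54 : sec54_charIdeal_classGroup_eq_unitIndex)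
    (hA : AcMainConjectureOrbitGrThree) (hB : AcBottomReadingGrThree)
    (hlaw : ∀ (W : WeierstrassCurve ℚ) [W.IsElliptic] [W.IsGloballyMinimal],
      W.HasCM → CMRamified W 3 → W.analyticRank = 1 → RamifiedCMBottomClassIndexLawAtZpThreeGr W) :
    Theses.PrintCFram.AnticyclotomicIndexLawThree :=
  forall_indexAtThreeT_of_orbitImc h54 hA hB hlaw

/-- **The same with ty2's GZK-threaded law hypothesis** (the `h2` shape of
`X12.O11.forall_indexAtThreeT_of_forall_imcGr_of_forall_indexLawGr`). [cite: GrossZagier1986, Thm. I.(7.3)]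
[cite: Kolyvagin1990, Thm. A] -/
theorem anticyclotomicIndexLawThree_of_orbitImc_of_GZK (h54 : sec54_charIdeal_classGroup_eq_unitIndex)
    (hA : AcMainConjectureOrbitGrThree) (hB : AcBottomReadingGrThree)
    (hlaw : rank_eq_analyticRank_of_analyticRank_le_one →
      ∀ (W : WeierstrassCurve ℚ) [W.IsElliptic] [W.IsGloballyMinimal],
      W.HasCM → CMRamified W 3 → W.analyticRank = 1 → RamifiedCMBottomClassIndexLawAtZpThreeGr W)
    (hGZK : rank_eq_analyticRank_of_analyticRank_le_one) :
    Theses.PrintCFram.AnticyclotomicIndexLawThree :=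
  forall_indexAtThreeT_of_orbitImc_of_GZK h54 hA hB hlaw hGZK

end Summit.BirchSwinnertonDyer.BirchSwinnertonDyer.Theorems.PrintCFram.OrbitImc

end
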